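import Summits.QuantumFields.BalabanUV.Beta.EriceRemainderEnclosureHistoryAutonomyComparisonBudgetedCriterion
import Summits.QuantumFields.BalabanUV.Beta.EriceRemainderEnclosureHistoryAutonomyComparisonGreedyChain

/-!
# EriceRemainderEnclosureHistoryAutonomyComparisonChainCriterion — (E65d) THE CHAIN CRITERION: `B(u) = b + Σ_{k<K} L_k·u_k` (ANY finite age set `A ⊆ [1,K[`,
# sizes and Markov weight ARBITRARY) compares at any size under every isotone excess as soon as, for every load vector `x ≥ 0` on `A` inside the WINDOW
# BUDGET of (E65a), the one-dimensional μ-CHAIN of (E65c) closes: `x_k(a_kμ_{k⁻} + 3∕4) < 1` along the ages in increasing order (`a_k = 4k⁻k∕(k+k⁻)²`,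
# `μ` propagated by `μ_k(1 − x_k(3∕4 + a_kμ_{k⁻})) ≥ a_kμ_{k⁻}(1 + x_k) + 3x_k∕4`).  (E65b) ∘ (E65c); the youngest-age condition `3x_{m₀}∕4 < 1` is discharged
# here from the budget (`x_k ≤ √2∕2`).  Conjecture (E58′) for the age set `A` is thereby the inequality «window budget ⟹ chain» on a polytope — numerically
# with room `0.59 < 1` on everything searched (`HOME/…/g58/e65/README.md`)

Cell `pub-balaban`, β-function sub-cell, BINDER row D4 «RemainderConst leaves for Bałaban's split» (`HOME/BINDER-OWNERS.md`; owner lineage `b2b-balaban-beta-an4`;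
this file by co-owner #2 lineage `b2b-balaban-beta-d4-p2`, generation 58), β-FLOW TEAM duty (1), FREEZE (0) honoured (def-free; (E65b)'s
`le_of_isotone_excess_budgeted_certificate`, (E65c)'s `certificate_of_chain`, (E65a)'s `mul_sqrt_le_readWindow` BY NAME; nothing restated).

HONEST FRAMING (page 1, verbatim and binding).  *"Discharging BetaPertH makes Bałaban's UV stability UNCONDITIONAL — a real constructive-QFT result; it is
NOT the continuum limit and NOT the Clay problem."*  THIS FILE DISCHARGES NOTHING OF THE KIND.  Elementary real analysis about ABSTRACT affine functionals on a
box ]0,γ]^ℕ with displayed supports and signs — hypotheses of a census, not facts; the form, signs, ages and moments of Bałaban's (1.22) limit functional are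
NOT PRINTED ([I] p. 298; GAPS G-t4-U2-1∕-2) and NOT asserted.  Row D4 class UNCHANGED (critical-path width 0; instance 0∕1; D4 DISCHARGE NO DATE).  HONEST
DEPENDENCY: continuum YM on T⁴ ⇐ BetaPertH ∧ nine spine estimates (0/9 proved); BetaPertH ⇐ (D1) ∧ (D4) ∧ CAP+tail; G-an2-4 gates asym, D1 and NE2/3/4.

THE POINT (census sense (α); the COMPARISON column, conjecture (E58′), route (C″)).  After (E65a)–(E65c) the comparison conjecture for a finite age set `A`
reads: for every `x ≥ 0` on `A` with `Σ_{k∈A} x_k·W_j(k) ≤ 1∕2` at every scale `j ≥ 1` (and `x_k ≤ L_k∕(2P_k)`), the minimal μ-chain satisfies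
`x_k(a_kμ_{k⁻} + 3∕4) < 1` at every age.  This file states that reduction as one theorem, so that the remaining work is an inequality between explicit
elementary functions of the ages and the loads — no trajectories, no functionals.  What the numerics say about that inequality (README, `chain2.py`,
exact sums, worst case over budgeted loads by random search + greedy fill): towers of every ratio `2…30` and heights to `12`, dense runs (`1..20`,
`50..69`), Fibonacci, mixed clusters, random sets of up to ten ages — the maximum of `x_k(a_kμ_{k⁻} + 3∕4)` is `0.59`, attained on tall towers; on most sets
the maximiser is a single loaded age (`3x∕4 ≤ 0.53`).  DOCFIX (same generation, after (E65e)–(E65h)): on TALL towers of small ratio the μ-chain ALONE DIVERGES — ratio `2`, uniform budgeted load `0.098`: the condition value passes `1` before height `20` with `a_k`, before height `80` even with the sharp one-step factor `(4∕3)(1 − (k∕(k+k⁻))²)` (README `chain3.out`) — because the one-step transport compounds where the true defect decays like `2^{−Δ}`; so «window budget ⟹ μ-chain» is FALSE in general and this END theorem is the right tool only for SHORT or well-separated chains; the general route is the DUAL chain of (E65e)∕(E65f) (age-weighted far-field potential added), whose condition value stays `≤ 0.53` everywhere searched and which carries (E65g)∕(E65h) (towers of ratio `≥ 10`, any height).  NOT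 CLAIMED: the inequality itself (OPEN for short chains, FALSE for tall dense towers); anything printed.

WHAT IS PROVED ([folklore]; 0 `def`, 0 sorry).  §1 `load_le_sqrt_two_div_two_of_budget` (`x_k ≤ √2∕2` from the budget at `j = k`).  §2
**`le_of_isotone_excess_of_budgeted_chain`** (END).
-/
noncomputable section
open Finset Set

namespace Summit.QuantumFields.BalabanUV.Beta.EriceRemainderEnclosureHistoryAutonomyComparisonChainCriterion

open Literature.MathematicalPhysics.QuantumFieldTheory.Balaban1983to89
open Literature.MathematicalPhysics.QuantumFieldTheory.Balaban1983to89.T4BetaStationary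
open Literature.MathematicalPhysics.QuantumFieldTheory.Balaban1983to89.T4BetaFlowWellPosed
open Summit.QuantumFields.BalabanUV.Beta.EriceRemainderEnclosureHistoryAutonomyComparisonLoadBudgetWindow (mul_sqrt_le_readWindow readWindow_nonneg)
open Summit.QuantumFields.BalabanUV.Beta.EriceRemainderEnclosureHistoryAutonomyComparisonBudgetedCriterion (le_of_isotone_excess_budgeted_certificate)
open Summit.QuantumFields.BalabanUV.Beta.EriceRemainderEnclosureHistoryAutonomyComparisonGreedyChain (certificate_of_chain)

variable {B' : (ℕ → ℝ) → ℝ} {M' γ b : ℝ} {L : ℕ → ℝ} {K : ℕ} {A : Finset ℕ} {h h' : ℕ → ℝ}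

/-! ## §1 The budget at the age's own scale bounds the load by `√2∕2` -/

/-- **A BUDGETED LOAD IS AT MOST `√2∕2`**: if `x ≥ 0` on `A` obeys the window budget `Σ_{k∈A} x_k·W_j(k) ≤ 1∕2` at the scale `j = k₀ ∈ A` (`k₀ ≥ 1`), then
`x_{k₀} ≤ √2∕2` — the own weight is `S_{k₀,k₀}∕k₀ ≥ √(k₀∕(2k₀)) = 1∕√2` ((E65a) `mul_sqrt_le_readWindow`).  In particular `3x_{k₀}∕4 < 1`. [folklore] -/
theorem load_le_sqrt_two_div_two_of_budget {x : ℕ → ℝ} {k₀ : ℕ} (hx : ∀ k ∈ A, 0 ≤ x k) (hk₀ : k₀ ∈ A) (hk₀1 : 1 ≤ k₀)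
    (hbud : ∑ k ∈ A, x k * (if k ≤ k₀ then (∑ l ∈ range k₀, Real.sqrt ((k : ℝ) / ((k : ℝ) + l + 1))) / k₀
        else (∑ l ∈ range k₀, Real.sqrt ((k : ℝ) / ((k : ℝ) + l + 1))) / k) ≤ 1 / 2) :
    x k₀ ≤ Real.sqrt 2 / 2 := by
  have hkr : (0 : ℝ) < k₀ := by exact_mod_cast hk₀1
  have hsingle := single_le_sum (f := fun k => x k * (if k ≤ k₀ then (∑ l ∈ range k₀, Real.sqrt ((k : ℝ) / ((k : ℝ) + l + 1))) / k₀
        else (∑ l ∈ range k₀, Real.sqrt ((k : ℝ) / ((k : ℝ) + l + 1))) / k))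
    (fun k hk => by have := hx k hk; have := readWindow_nonneg k k₀; split_ifs <;> positivity) hk₀
  have h1 : x k₀ * ((∑ l ∈ range k₀, Real.sqrt ((k₀ : ℝ) / ((k₀ : ℝ) + l + 1))) / k₀) ≤ 1 / 2 := by
    have := hsingle.trans hbud
    simpa only [le_refl, if_true] using this
  -- the own weight is at least 1/√2
  have hS := mul_sqrt_le_readWindow k₀ k₀
  have hhalf : Real.sqrt ((k₀ : ℝ) / ((k₀ : ℝ) + k₀)) = Real.sqrt 2 / 2 := by
    rw [show (k₀ : ℝ) / ((k₀ : ℝ) + k₀) = 1 / 2 by field_simp; ring]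
    rw [show (1 : ℝ) / 2 = (Real.sqrt 2 / 2) ^ 2 by rw [div_pow, Real.sq_sqrt (by norm_num)]; norm_num]
    exact Real.sqrt_sq (by positivity)
  rw [hhalf] at hS
  have hW : Real.sqrt 2 / 2 ≤ (∑ l ∈ range k₀, Real.sqrt ((k₀ : ℝ) / ((k₀ : ℝ) + l + 1))) / k₀ := by
    rw [le_div_iff₀ hkr]; linarith
  have h2 : x k₀ * (Real.sqrt 2 / 2) ≤ 1 / 2 := (mul_le_mul_of_nonneg_left hW (hx k₀ hk₀)).trans h1
  -- x ≤ (1/2)/(√2/2) = 1/√2 = √2/2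
  have hs2 : Real.sqrt 2 / 2 * (Real.sqrt 2 / 2) = 1 / 2 := by
    rw [show Real.sqrt 2 / 2 * (Real.sqrt 2 / 2) = (Real.sqrt 2) ^ 2 / 4 by ring, Real.sq_sqrt (by norm_num)]; norm_num
  have hpos : (0 : ℝ) < Real.sqrt 2 / 2 := by positivity
  nlinarith [h2, hs2, hpos]

/-! ## §2 END: comparison at any size when the window budget closes the μ-chain -/

/-- **THE CHAIN CRITERION.**  `B(u) = b + Σ_{k<K} L_k·u_k` on ]0,γ] (`b > 0`, `L ≥ 0` supported on `{0} ∪ A`, `A ⊆ [1,K[` ANY finite set of ages with minimum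
`m₀` and predecessor map `pred`; sizes and Markov weight ARBITRARY).  Suppose that for EVERY load vector `x ≥ 0` on `A` obeying (E58b)'s profile bound and
(E65a)'s window budget at every scale `j ≥ 1` there are chain values `μ ≥ 0` on `A` with `μ_{m₀}(1 − 3x_{m₀}∕4) ≥ 3x_{m₀}∕4` and, for every `k ≠ m₀` in `A`
(`a_k = 4·pred k·k∕(k + pred k)²`): **`x_k(a_kμ_{pred k} + 3∕4) < 1`** and `μ_k(1 − x_k(3∕4 + a_kμ_{pred k})) ≥ a_kμ_{pred k}(1 + x_k) + 3x_k∕4`.  Then for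
every `B′ ≥ B` with a zeroth moment and an ISOTONE excess, ANY box solutions from one pin satisfy `h′ ≤ h` at EVERY scale — (E65b) with the certificate of
(E65c) (`3x_{m₀}∕4 < 1` from §1). [folklore] -/
theorem le_of_isotone_excess_of_budgeted_chain {p : ℝ} {pred : ℕ → ℕ} {m₀ : ℕ} (hL : ∀ k, 0 ≤ L k) (hb : 0 < b) (hAK : A ⊆ range K)
    (hA1 : ∀ k ∈ A, 1 ≤ k) (hsupp : ∀ k ∈ range K, k ∉ A → k ≠ 0 → L k = 0) (hm₀ : m₀ ∈ A) (hmin : ∀ k ∈ A, m₀ ≤ k)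
    (hpred : ∀ k ∈ A, k ≠ m₀ → pred k ∈ A ∧ pred k < k ∧ ∀ k'' ∈ A, k'' < k → k'' ≤ pred k)
    (hchain : ∀ x : ℕ → ℝ, (∀ k ∈ A, 0 ≤ x k) →
      (∀ k ∈ A, x k ≤ L k / (2 * ∑ k' ∈ range K, L k' * Real.sqrt ((k : ℝ) / ((k : ℝ) + k')))) →
      (∀ j : ℕ, 1 ≤ j → ∑ k ∈ A, x k *
        (if k ≤ j then (∑ l ∈ range j, Real.sqrt ((k : ℝ) / ((k : ℝ) + l + 1))) / j
          else (∑ l ∈ range j, Real.sqrt ((k : ℝ) / ((k : ℝ) + l + 1))) / k) ≤ 1 / 2) →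
      ∃ μ : ℕ → ℝ, (∀ k ∈ A, 0 ≤ μ k) ∧ 3 / 4 * x m₀ ≤ μ m₀ * (1 - 3 / 4 * x m₀) ∧
        (∀ k ∈ A, k ≠ m₀ → x k * (4 * (pred k : ℝ) * k / ((k : ℝ) + pred k) ^ 2 * μ (pred k) + 3 / 4) < 1) ∧
        (∀ k ∈ A, k ≠ m₀ → 4 * (pred k : ℝ) * k / ((k : ℝ) + pred k) ^ 2 * μ (pred k) * (1 + x k) + 3 / 4 * x k ≤
          μ k * (1 - x k * (3 / 4 + 4 * (pred k : ℝ) * k / ((k : ℝ) + pred k) ^ 2 * μ (pred k)))))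
    (hB' : ∀ u u' : ℕ → ℝ, SeqBox γ u → SeqBox γ u' → ∀ D : ℝ, (∀ j, |u j - u' j| ≤ D) → |B' u - B' u'| ≤ M' * D) (hM' : 0 ≤ M')
    (hexc : ∀ u, SeqBox γ u → (fun u : ℕ → ℝ => b + ∑ k ∈ range K, L k * u k) u ≤ B' u)
    (hDmono : ∀ u v : ℕ → ℝ, SeqBox γ u → SeqBox γ v → (∀ j, u j ≤ v j) →
      B' u - (fun u : ℕ → ℝ => b + ∑ k ∈ range K, L k * u k) u ≤ B' v - (fun u : ℕ → ℝ => b + ∑ k ∈ range K, L k * u k) v)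
    (hp : 0 < p) (hpγ : p ≤ γ) (hh : SeqBox γ h) (hf : MemFlow (fun u : ℕ → ℝ => b + ∑ k ∈ range K, L k * u k) p h)
    (hh' : SeqBox γ h') (hf' : MemFlow B' p h') (j : ℕ) : h' j ≤ h j := by
  refine le_of_isotone_excess_budgeted_certificate hL hb hAK hA1 hsupp (fun x hx hP hbud => ?_) hB' hM' hexc hDmono hp hpγ hh hf hh' hf' j
  obtain ⟨μ, hμ, hμ₀, hcond, hrec⟩ := hchain x hx hP hbud
  have hx₀ : 3 / 4 * x m₀ < 1 := by
    have h1 := load_le_sqrt_two_div_two_of_budget hx hm₀ (hA1 m₀ hm₀) (hbud m₀ (hA1 m₀ hm₀))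
    have h2 : Real.sqrt 2 < 2 := by
      have h3 : Real.sqrt 2 < Real.sqrt (2 ^ 2) := Real.sqrt_lt_sqrt (by norm_num) (by norm_num)
      rwa [Real.sqrt_sq (by norm_num : (0 : ℝ) ≤ 2)] at h3
    linarith
  exact certificate_of_chain hA1 hx hm₀ hmin hpred hμ hx₀ hμ₀ hcond hrec

end Summit.QuantumFields.BalabanUV.Beta.EriceRemainderEnclosureHistoryAutonomyComparisonChainCriterion

end
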